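import Summits.CriticalPhenomena.SAWScalingLimit.Theorems.BoundaryTP2.Negative.TP2CertArith
import Summits.CriticalPhenomena.SAWScalingLimit.Theorems.EdgeOfPositivity.Negative.EdgeOfPositivityBoxCertificates
import Summits.CriticalPhenomena.SAWScalingLimit.Theorems.BoundaryTP2Negative_Box3
import HarnessLib

/-!
# Crux `BoundaryTP2` (stmt-CriticalPhenomena-7115): a kernel-checkable circular-TP₂ certificate kit

Certified-compute seat (refuter, `ccert`), part 2.  For a lattice box `rectDomain a b` (sites
`{0..a} × {0..b}`, a bounded simply connected domain at mesh `1` whose domain graph is `ℤ²` induced on the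
box, `EdgeOfPositivityRectDomain`) and a list `bd` of box sites (the boundary cycle in the instance files),
this file reduces the circular TP₂ inequalities

  `Z(bᵢ,bₖ) Z(bⱼ,bₗ) ≤ Z(bᵢ,bⱼ) Z(bₖ,bₗ)` and `Z(bᵢ,bₖ) Z(bⱼ,bₗ) ≤ Z(bᵢ,bₗ) Z(bⱼ,bₖ)`, `i < j < k < l`,

for the fugacity-`x` two-point sums `Z = Zx x (rectDomain a b) 1` at EVERY `x ∈ [10/27, 5/13] ⊇ [1/2.7, 1/2.6]`
(hence at `x_c` under the quoted bounds `2.6 ≤ μ ≤ 2.7`, for the crux's `SAW.weight … univ`) to two kernel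
computations:

* `pathCount a b u v` — the exact coefficient vector of `Z(u,v) = Σ_k c_k x^k` (`c_k` = number of `k`-step
  SAWs `u → v` of the box), from the proved-complete and proved-sound enumerator `boxPaths`, which is
  duplicate-free (`allPaths_nodup`); `Zx_eq_evPoly`; one `decide` per pair in the instance files;
* `certAll` (part 1, `TP2CertArith`) — the exact-arithmetic adaptive subdivision certificate.

`tp2_of_certAll` / `tp2_weight_of_certAll` assemble them.  Everything proved; no Theses statement is
asserted (TP₂ instances on explicit domains are small-model facts). [folklore]
-/

namespace Summit.CriticalPhenomena.SAWScalingLimit.Theorems.BoundaryTP2.Negative.Cert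

open Literature.Probability.LatticeModels Literature.Probability.RandomPlanarGeometry
open Summit.CriticalPhenomena.SAWScalingLimit.Theorems.EdgeOfPositivity.Negative
open scoped ENNReal

/-! ## §4 Exact two-point polynomials of a box from the proved enumerator `boxPaths` -/

/-- Increment the `n`-th coefficient (padding with zeros). [folklore] -/
def bump : List ℕ → ℕ → List ℕ
  | [], 0 => [1]
  | [], n + 1 => 0 :: bump [] n
  | c :: cs, 0 => (c + 1) :: cs
  | c :: cs, n + 1 => c :: bump cs n

/-- Histogram of a list of exponents, as a coefficient list. [folklore] -/
def hist : List ℕ → List ℕ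
  | [] => []
  | n :: ns => bump (hist ns) n

/-- `bump` adds the monomial `x^n`. [folklore] -/
theorem evPoly_bump : ∀ (c : List ℕ) (n : ℕ) (x : ℝ), evPoly (bump c n) x = evPoly c x + x ^ n
  | [], 0, x => by simp [bump]
  | [], n + 1, x => by rw [bump, evPoly_cons, evPoly_bump [] n x]; simp [pow_succ]; ring
  | c :: cs, 0, x => by simp [bump]; ring
  | c :: cs, n + 1, x => by rw [bump, evPoly_cons, evPoly_bump cs n x, evPoly_cons, pow_succ]; ring

/-- The histogram evaluates to the sum of the monomials. [folklore] -/
theorem evPoly_hist (x : ℝ) : ∀ ns : List ℕ, evPoly (hist ns) x = (ns.map fun n => x ^ n).sum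
  | [] => by simp [hist]
  | n :: ns => by rw [hist, evPoly_bump, evPoly_hist x ns]; simp [add_comm]

/-- **The coefficient vector of `Z(u,v)` on the box `{0..a} × {0..b}`**: entry `k` is the number of
`k`-step SAWs `u → v` of the box (kernel-computable from `boxPaths`). [folklore] -/
def pathCount (a b : ℕ) (u v : Site 2) : List ℕ := hist ((boxPaths a b u v).map fun L => L.length - 1)

/-- The site list of a box has no duplicates. [folklore] -/
theorem boxList_nodup (a b : ℕ) : (boxList a b).Nodup := by
  unfold boxList
  rw [List.nodup_flatMap]
  constructor
  · intro i _
    refine List.nodup_range.map ?_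
    intro j j' h
    have h1 := congrArg (fun v : Site 2 => v 1) h
    simpa using h1
  · refine List.nodup_range.imp ?_
    intro i i' hne
    refine List.disjoint_left.mpr ?_
    intro v hv hv'
    rw [List.mem_map] at hv hv'
    obtain ⟨j, -, rfl⟩ := hv
    obtain ⟨j', -, h⟩ := hv'
    have h0 := congrArg (fun v : Site 2 => v 0) h
    simp only [st_zero, Nat.cast_inj] at h0
    exact hne h0.symm

/-- The enumerator produces no duplicates (neighbour lists without duplicates). [folklore] -/
theorem allPaths_nodup {α : Type*} [DecidableEq α] (nbr : α → List α) (hn : ∀ v, (nbr v).Nodup) (tgt : α) :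
    ∀ (fuel : ℕ) (cur : α) (vis : List α), (allPaths nbr tgt fuel cur vis).Nodup := by
  intro fuel
  induction fuel with
  | zero => intro cur vis; unfold allPaths; split_ifs <;> simp
  | succ fuel ih =>
    intro cur vis
    unfold allPaths
    split_ifs with h
    · simp
    · rw [List.nodup_flatMap]
      constructor
      · intro w _
        exact (ih w (cur :: vis)).map List.cons_injective
      · refine ((hn cur).filter _).imp ?_
        intro w w' hne
        refine List.disjoint_left.mpr ?_
        intro L hL hL'
        rw [List.mem_map] at hL hL'
        obtain ⟨r, hr, rfl⟩ := hL
        obtain ⟨r', hr', hrr⟩ := hL'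
        have hrr' : r' = r := List.cons_injective hrr
        obtain ⟨rest, hrest, -⟩ := allPaths_sound nbr tgt fuel w (cur :: vis) r hr
        obtain ⟨rest', hrest', -⟩ := allPaths_sound nbr tgt fuel w' (cur :: vis) r' hr'
        rw [hrr', hrest] at hrest'
        exact hne (List.cons.inj hrest').1

/-- `boxPaths` has no duplicates. [folklore] -/
theorem boxPaths_nodup (a b : ℕ) (u v : Site 2) : (boxPaths a b u v).Nodup :=
  allPaths_nodup _ (fun _ => (boxList_nodup a b).filter _) _ _ _ _

/-- **Exact two-point polynomial**: `Z_x(u,v) = Σ_k (pathCount a b u v)_k x^k` on the box, for a box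
site `u` and `x ≥ 0`. [folklore] -/
theorem Zx_eq_evPoly {a b : ℕ} {u v : Site 2} (hu : u ∈ rectSites a b) {x : ℝ} (hx : 0 ≤ x) :
    Zx x (rectDomain a b) 1 u v = ENNReal.ofReal (evPoly (pathCount a b u v) x) := by
  rw [Zx_box_eq_sum x hu, List.sum_toFinset _ (boxPaths_nodup a b u v), pathCount, evPoly_hist,
    ← sum_map_ofReal_pow hx, List.map_map]
  rfl

/-! ## §5 Assembly: from the two kernel computations to the TP₂ inequalities -/

/-- Boolean membership in the box `{0..a} × {0..b}`. [folklore] -/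
def inRect (a b : ℕ) (u : Site 2) : Bool :=
  decide (0 ≤ u 0) && decide (u 0 ≤ (a : ℤ)) && decide (0 ≤ u 1) && decide (u 1 ≤ (b : ℤ))

/-- `inRect` is sound. [folklore] -/
theorem mem_rectSites_of_inRect {a b : ℕ} {u : Site 2} (h : inRect a b u = true) : u ∈ rectSites a b := by
  simp only [inRect, Bool.and_eq_true, decide_eq_true_eq] at h
  exact ⟨⟨h.1.1.1, h.1.1.2⟩, h.1.2, h.2⟩

/-- All listed sites lie in the box (a `decide`). [folklore] -/
theorem forall_mem_rectSites_of_all {a b : ℕ} {bd : List (Site 2)} (h : bd.all (inRect a b) = true) :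
    ∀ u ∈ bd, u ∈ rectSites a b := fun u hu =>
  mem_rectSites_of_inRect (List.all_eq_true.1 h u hu)

/-- Table lookup agrees with `pathCount` on the listed pairs. [folklore] -/
theorem cf_eq_pathCount {a b : ℕ} {bd : List (Site 2)} {ctab : List (List (List ℕ))}
    (hct : (rowsOf bd).map (List.map fun p : Site 2 × Site 2 => pathCount a b p.1 p.2) = ctab)
    {i j : ℕ} (hij : i < j) (hj : j < bd.length) :
    cf ctab i j = pathCount a b (bd.getD i 0) (bd.getD j 0) := by
  obtain ⟨h1, h2⟩ := rowsOf_getD (0 : Site 2) bd i (j - i - 1) (by omega)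
  rw [show i + 1 + (j - i - 1) = j by omega] at h1
  have ht : j - i - 1 < ((rowsOf bd).getD i []).length := by rw [h2]; omega
  rw [cf, ← hct, show ([] : List (List ℕ)) = List.map (fun p : Site 2 × Site 2 => pathCount a b p.1 p.2) [] from rfl,
    List.getD_map, List.getD_eq_getElem _ _ (by simpa using ht), List.getElem_map,
    ← List.getD_eq_getElem _ ((0 : Site 2), (0 : Site 2)) ht, h1]

/-- **Circular TP₂ on a box from the certificate.** For box sites `bd` (in the instance files: the
boundary cycle), the exact table `ctab` of two-point polynomials of all pairs `i < j`, and a passing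
certificate, BOTH non-crossing pairings dominate the crossing one for every `i < j < k < l` and every
fugacity `x ∈ [10/27, 5/13] ⊇ [1/2.7, 1/2.6]`. [folklore] -/
theorem tp2_of_certAll {a b : ℕ} {bd : List (Site 2)} (hbd : ∀ u ∈ bd, u ∈ rectSites a b)
    {ctab : List (List (List ℕ))}
    (hct : (rowsOf bd).map (List.map fun p : Site 2 × Site 2 => pathCount a b p.1 p.2) = ctab)
    {K F : ℕ} (hcert : certAll bd.length K F ctab = true) {x : ℝ} (hlo : 10 / 27 ≤ x) (hhi : x ≤ 5 / 13)
    {i j k l : ℕ} (hij : i < j) (hjk : j < k) (hkl : k < l) (hl : l < bd.length) :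
    Zx x (rectDomain a b) 1 (bd.getD i 0) (bd.getD k 0) * Zx x (rectDomain a b) 1 (bd.getD j 0) (bd.getD l 0) ≤
        Zx x (rectDomain a b) 1 (bd.getD i 0) (bd.getD j 0) * Zx x (rectDomain a b) 1 (bd.getD k 0) (bd.getD l 0) ∧
      Zx x (rectDomain a b) 1 (bd.getD i 0) (bd.getD k 0) * Zx x (rectDomain a b) 1 (bd.getD j 0) (bd.getD l 0) ≤
        Zx x (rectDomain a b) 1 (bd.getD i 0) (bd.getD l 0) * Zx x (rectDomain a b) 1 (bd.getD j 0) (bd.getD k 0) := by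
  have hx : 0 ≤ x := le_trans (by norm_num) hlo
  have hmem : ∀ n, n < bd.length → bd.getD n 0 ∈ rectSites a b := fun n hn => by
    rw [List.getD_eq_getElem _ _ hn]; exact hbd _ (List.getElem_mem hn)
  have hZ : ∀ {s t : ℕ}, s < t → t < bd.length →
      Zx x (rectDomain a b) 1 (bd.getD s 0) (bd.getD t 0) = ENNReal.ofReal (evPoly (cf ctab s t) x) := by
    intro s t hst ht
    rw [Zx_eq_evPoly (hmem s (hst.trans ht)) hx, cf_eq_pathCount hct hst ht]
  obtain ⟨h1, h2⟩ := poly_of_certAll hcert hij hjk hkl hl hlo hhi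
  have hik : i < k := hij.trans hjk
  have hjl : j < l := hjk.trans hkl
  have hil : i < l := hik.trans hkl
  have hk : k < bd.length := hkl.trans hl
  have hj : j < bd.length := hjk.trans hk
  rw [hZ hik hk, hZ hjl hl, hZ hij hj, hZ hkl hl, hZ hil hl, hZ hjk hk,
    ← ENNReal.ofReal_mul (evPoly_nonneg _ hx), ← ENNReal.ofReal_mul (evPoly_nonneg _ hx),
    ← ENNReal.ofReal_mul (evPoly_nonneg _ hx)]
  exact ⟨ENNReal.ofReal_le_ofReal h1, ENNReal.ofReal_le_ofReal h2⟩

/-- Under the quoted bounds `2.6 ≤ μ ≤ 2.7`, `x_c ∈ [10/27, 5/13]`. [folklore] -/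
theorem xc_mem_interval (hμ : SAW.LawlerSchrammWerner2004SAW_connectiveConstant_bounds) :
    10 / 27 ≤ SAW.criticalFugacity ∧ SAW.criticalFugacity ≤ 5 / 13 := by
  obtain ⟨h26, h27⟩ := hμ
  constructor
  · rw [SAW.criticalFugacity, le_inv_comm₀ (by norm_num) (by linarith)]
    norm_num; linarith
  · rw [SAW.criticalFugacity, inv_le_comm₀ (by linarith) (by norm_num)]
    norm_num; linarith

/-- The crux's partition function is `Zx` at `x_c`. [folklore] -/
theorem weight_eq_Zx (Ω : Set ℂ) (δ : ℝ) (u v : Site 2) :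
    SAW.weight Ω δ u v Set.univ = Zx SAW.criticalFugacity Ω δ u v :=
  weight_univ Ω δ u v

/-- **At the critical fugacity, in the crux's own terms**: for the listed box sites and `i < j < k < l`,
with `(p₁,p₂,p₃,p₄) = (bᵢ,bⱼ,bₖ,bₗ)`, `Z(p₁,p₃)Z(p₂,p₄) ≤ Z(p₁,p₂)Z(p₃,p₄)` (the conclusion of
`BoundaryTP2` for `Ω = rectDomain a b`, `δ = 1`) and `Z(p₁,p₃)Z(p₂,p₄) ≤ Z(p₁,p₄)Z(p₂,p₃)`, where
`Z = SAW.weight (rectDomain a b) 1 · · univ`; conditional only on the quoted bounds `2.6 ≤ μ ≤ 2.7`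
(discharged computationally in the tree). [folklore] -/
theorem tp2_weight_of_certAll (hμ : SAW.LawlerSchrammWerner2004SAW_connectiveConstant_bounds)
    {a b : ℕ} {bd : List (Site 2)} (hbd : ∀ u ∈ bd, u ∈ rectSites a b)
    {ctab : List (List (List ℕ))}
    (hct : (rowsOf bd).map (List.map fun p : Site 2 × Site 2 => pathCount a b p.1 p.2) = ctab)
    {K F : ℕ} (hcert : certAll bd.length K F ctab = true)
    {i j k l : ℕ} (hij : i < j) (hjk : j < k) (hkl : k < l) (hl : l < bd.length) :
    SAW.weight (rectDomain a b) 1 (bd.getD i 0) (bd.getD k 0) Set.univ *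
          SAW.weight (rectDomain a b) 1 (bd.getD j 0) (bd.getD l 0) Set.univ ≤
        SAW.weight (rectDomain a b) 1 (bd.getD i 0) (bd.getD j 0) Set.univ *
          SAW.weight (rectDomain a b) 1 (bd.getD k 0) (bd.getD l 0) Set.univ ∧
      SAW.weight (rectDomain a b) 1 (bd.getD i 0) (bd.getD k 0) Set.univ *
          SAW.weight (rectDomain a b) 1 (bd.getD j 0) (bd.getD l 0) Set.univ ≤
        SAW.weight (rectDomain a b) 1 (bd.getD i 0) (bd.getD l 0) Set.univ *
          SAW.weight (rectDomain a b) 1 (bd.getD j 0) (bd.getD k 0) Set.univ := by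
  simp only [weight_eq_Zx]
  exact tp2_of_certAll hbd hct hcert (xc_mem_interval hμ).1 (xc_mem_interval hμ).2 hij hjk hkl hl

/-- The diagonal of the table: only the trivial path joins a site to itself, `Z(u,u) = 1`. [folklore] -/
theorem pathCount_self (a b : ℕ) (u : Site 2) : pathCount a b u u = [1] := by
  unfold pathCount boxPaths
  cases (a + 1) * (b + 1) - 1 <;> simp [allPaths, hist, bump]

end Summit.CriticalPhenomena.SAWScalingLimit.Theorems.BoundaryTP2.Negative.Cert
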